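import Summits.BirchSwinnertonDyer.BirchSwinnertonDyer.Theses.ErratumRoadFive
import Summits.BirchSwinnertonDyer.BirchSwinnertonDyer.Theorems.ErratumRoadFiveNonSurjCornerTwinMuAnUnitValue
import Literature.NumberTheory.EllipticCurves.PAdicBSD
import HarnessLib

/-!
# Line «anchors» — crux `NonSurjCornerTwinMuAnDeep` (stmt-BirchSwinnertonDyer-23047; ErratumRoadFive r602)

LINE-WRITER SKELETON (linewriter-bsd-display13-1 g0, 2026-08-31); NOT leaf progress; BSD is proved for no curve.

The crux (route decl `Theses.ErratumRoadFive.NonSurjCornerTwinMuAnDeep` := the Theorems constant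
`Theorems.NonSurjCornerTwinMuAnDeep`): analytic `μ = 0` at `p ∈ {5,7}`, Néron–MTT normalisation «some coefficient of `ϖ·L_p(f, a)` is a
`p`-adic unit», for every Friedberg–Hoffstein twin `Wd = Cd • E^{(d_K)}` of a DEEP corner pair `(E,p)` (`ClassX11b E p`, `ρ̄_{E,p}` not onto,
`p ∣ ord_p Δ_min`, no (ram) witness, `0 < ord_p #Ш_an(E)`); `Wd` is a non-surjective X11a leaf with `p ∣ ord_p Δ_min(Wd)` (displayed binders).

CUT «certificate-or-transfer, by the sign of the twin at p» (transplant of the `p = 3` line `Cruxes/CornerTwistMuAnAtThree/Lines/anchors.lean`):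
* NON-SPLIT (`a = −1`): ON the unit-value locus `‖ϖ·[0]⁺_f‖_p = 1` — LANDED `Theorems.nonSurjCornerTwinMuAn_nonsplit_of_unit_value` BY NAME
  (no stub); OFF it — RESEARCH `stub_nonsplitRowsOffUnitValue` (EPW transfer from a unit-canonical-value member of `H(ρ̄)`).
* SPLIT (`a = 1`, exceptional zero): ON the unit-derivative locus `∃ Dq, ‖ℒ_p(Dq)·ϖ·[0]⁺_f‖_p = ‖log_p γ‖_p` — PRINT `stub_splitRowsOfUnitDerivative`
  [print: GreenbergStevens1993 Thm. (0.3) = tree fact `greenberg_stevens Wd p`, `p ≥ 5` in range]; OFF it — RESEARCH `stub_splitRowsOffUnitDerivative`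
  (anomalous partners only; transfer from an anchored — e.g. CM — member).
The DEEP hypothesis `p ∣ ord_p Δ_min(Wd) = p ∣ ord_p q_{Wd}` is what lets `‖ℒ_p‖_p = ‖log_p u_q‖/‖ord_p q‖` reach the unit-derivative locus.
-/

set_option autoImplicit false
set_option linter.dupNamespace false

noncomputable section

namespace Summit.BirchSwinnertonDyer.BirchSwinnertonDyer.Cruxes.NonSurjCornerTwinMuAnDeep.Anchors

open CongruenceSubgroup WeierstrassCurve Literature.NumberTheory.EllipticCurves
  Literature.NumberTheory.EllipticCurves.ModularForms Literature.NumberTheory.EllipticCurves.Rank1Residual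
  Summit.BirchSwinnertonDyer.Rank1Residual

/-! ## Stubs -/

/-- **[print] `stub_splitRowsOfUnitDerivative`** — SPLIT twins ON the unit-derivative locus: if some Tate parameter datum `Dq` of `Wd` at
`p` has `‖ℒ_p(Dq) · ϖ · [0]⁺_f‖_p = ‖log_p γ‖_p`, then `[T¹](ϖ·L)` is a `p`-adic unit. Print: Greenberg–Stevens 1993 Thm. (0.3)
(`greenberg_stevens Wd p`: `[T¹]L · log_p γ = ℒ_p · [0]⁺_f`, `[T⁰]L = 0`), `log_p γ ≠ 0` (`padicLog_cyclotomicGenerator_ne_zero`); S-sized algebra.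
[cite: GreenbergStevens1993, Thm. (0.3) (p. 407)] [cite: Kobayashi2006DocMath, Cor. 4.2] -/
theorem stub_splitRowsOfUnitDerivative :
    ∀ (W : WeierstrassCurve ℚ) [W.IsElliptic] [W.IsGloballyMinimal] (p : ℕ) [Fact p.Prime],
      ClassX11b W p → ¬ Surj W p → (p = 5 ∨ p = 7) → p ∣ padicValInt p W.minimalDiscriminantInt →
      ¬ Ram W p → (∃ s : ℚ, shaAn W = (s : ℂ) ∧ 0 < padicValRat p s) →
      ∀ (K : Type) [Field K] [NumberField K] (Wd : WeierstrassCurve ℚ) [Wd.IsElliptic] [Wd.IsGloballyMinimal]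
        (Cd : VariableChange ℚ),
        IsImaginaryQuadratic K → SatisfiesHeegnerHypothesis (W.conductorNorm ℤ) K →
        (W.quadraticTwist (NumberField.discr K : ℚ)).entireLFunction 1 ≠ 0 →
        Cd • W.quadraticTwist (NumberField.discr K : ℚ) = Wd →
        ClassX11a Wd p → ¬ Surj Wd p → p ∣ padicValInt p Wd.minimalDiscriminantInt →
        Wd.HasSplitMultiplicativeReductionAtPrime p →
        ∀ {N : ℕ} [NeZero N] (f : CuspForm (Gamma0 N) 2), IsNewformOf Wd f →
        ∀ (ϖ : ℚ), (ϖ : ℝ) * Wd.realPeriodRat = plusPeriod f →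
        (∃ Dq : TateParameterData Wd p,
            ‖LInvariant Dq * (((ϖ : ℚ) : ℚ_[p]) * (ratPlusSymbol f 0 : ℚ_[p]))‖ =
              ‖padicLog p (cyclotomicGenerator p : ℚ_[p])‖) →
        ∀ (L : PowerSeries ℚ_[p]), IsMultPAdicLFunctionOf f p 1 L →
          ∃ n : ℕ, ‖PowerSeries.coeff n (PowerSeries.C ((ϖ : ℚ) : ℚ_[p]) * L)‖ = 1 := by
  sorry

/-- **[research] `stub_nonsplitRowsOffUnitValue`** — NON-SPLIT twins OFF the unit-value locus (`λ ≥ 1`): `ϖ·L_p(f, −1)` still has a unit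
coefficient. Technique: congruence transfer (EPW 2006 Thm. 1; `ρ̄ = Wd[p]` irreducible, `p`-distinguished as `Wd` is multiplicative at `p`)
from a member of `H(ρ̄)` with a unit leading coefficient — at `p = 5` an elliptic partner in `X_{Wd[5]}(5) ≅ ℙ¹` (Rubin–Silverberg), good
ordinary and automatically non-anomalous (`a₅ ≡ −1`), with unit `L(A,1)/Ω_A`; at `p = 7` (`X(7)` has genus 3) a level-raised NEWFORM
(Diamond–Taylor) with unit canonical `L`-value (Vatsal 1999) — plus period bookkeeping at `p ∥ N`. Why it might fail: the partner supply is an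
open ∀∃; whether an SU-(ram) anchor exists depends on a unipotent in the (proper, irreducible) image of `ρ̄` — to be checked per image class.
[cite: EmertonPollackWeston2006, Thm. 1] [cite: GreenbergVatsal2000, Thm. (1.4)] [cite: Vatsal1999, Thm. (0.3)] [cite: DiamondTaylor1994, Thm. A] -/
theorem stub_nonsplitRowsOffUnitValue :
    ∀ (W : WeierstrassCurve ℚ) [W.IsElliptic] [W.IsGloballyMinimal] (p : ℕ) [Fact p.Prime],
      ClassX11b W p → ¬ Surj W p → (p = 5 ∨ p = 7) → p ∣ padicValInt p W.minimalDiscriminantInt →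
      ¬ Ram W p → (∃ s : ℚ, shaAn W = (s : ℂ) ∧ 0 < padicValRat p s) →
      ∀ (K : Type) [Field K] [NumberField K] (Wd : WeierstrassCurve ℚ) [Wd.IsElliptic] [Wd.IsGloballyMinimal]
        (Cd : VariableChange ℚ),
        IsImaginaryQuadratic K → SatisfiesHeegnerHypothesis (W.conductorNorm ℤ) K →
        (W.quadraticTwist (NumberField.discr K : ℚ)).entireLFunction 1 ≠ 0 →
        Cd • W.quadraticTwist (NumberField.discr K : ℚ) = Wd →
        ClassX11a Wd p → ¬ Surj Wd p → p ∣ padicValInt p Wd.minimalDiscriminantInt →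
        ¬ Wd.HasSplitMultiplicativeReductionAtPrime p →
        ∀ {N : ℕ} [NeZero N] (f : CuspForm (Gamma0 N) 2), IsNewformOf Wd f →
        ∀ (ϖ : ℚ), (ϖ : ℝ) * Wd.realPeriodRat = plusPeriod f →
        ‖((ϖ : ℚ) : ℚ_[p]) * (ratPlusSymbol f 0 : ℚ_[p])‖ ≠ 1 →
        ∀ (L : PowerSeries ℚ_[p]), IsMultPAdicLFunctionOf f p (-1) L →
          ∃ n : ℕ, ‖PowerSeries.coeff n (PowerSeries.C ((ϖ : ℚ) : ℚ_[p]) * L)‖ = 1 := by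
  sorry

/-- **[research] `stub_splitRowsOffUnitDerivative`** — SPLIT twins with NO `Dq` on the unit-derivative locus: the split function
`ϖ·L_p(f, 1)` still has a unit coefficient. No local certificate survives (exceptional zero; `[T¹]` non-unit; every good-ordinary member of
`H(ρ̄)` has `a_p ≡ 1`, anomalous), so only transfer (EPW Thm. 1) from a member with `μ = 0` KNOWN: a CM anchor when `ρ̄ ≅ Ind_M ψ̄` with `M`
imaginary and `p` split in `M` — whose cyclotomic `μ = 0` is in print only for the split-prime tower (Gillard 1985/1987, Schneps 1987), presumed
open in the cyclotomic direction — or a member with a certified unit leading coefficient. Why it might fail: that input open; no anchor at all when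
`ρ̄` is not so induced. [cite: EmertonPollackWeston2006, Thm. 1] [cite: GreenbergLNM1716, §1 Conj. 1.11] [cite: Gillard1985Crelle, Thm. 1] -/
theorem stub_splitRowsOffUnitDerivative :
    ∀ (W : WeierstrassCurve ℚ) [W.IsElliptic] [W.IsGloballyMinimal] (p : ℕ) [Fact p.Prime],
      ClassX11b W p → ¬ Surj W p → (p = 5 ∨ p = 7) → p ∣ padicValInt p W.minimalDiscriminantInt →
      ¬ Ram W p → (∃ s : ℚ, shaAn W = (s : ℂ) ∧ 0 < padicValRat p s) →
      ∀ (K : Type) [Field K] [NumberField K] (Wd : WeierstrassCurve ℚ) [Wd.IsElliptic] [Wd.IsGloballyMinimal]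
        (Cd : VariableChange ℚ),
        IsImaginaryQuadratic K → SatisfiesHeegnerHypothesis (W.conductorNorm ℤ) K →
        (W.quadraticTwist (NumberField.discr K : ℚ)).entireLFunction 1 ≠ 0 →
        Cd • W.quadraticTwist (NumberField.discr K : ℚ) = Wd →
        ClassX11a Wd p → ¬ Surj Wd p → p ∣ padicValInt p Wd.minimalDiscriminantInt →
        Wd.HasSplitMultiplicativeReductionAtPrime p →
        ∀ {N : ℕ} [NeZero N] (f : CuspForm (Gamma0 N) 2), IsNewformOf Wd f →
        ∀ (ϖ : ℚ), (ϖ : ℝ) * Wd.realPeriodRat = plusPeriod f →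
        (¬ ∃ Dq : TateParameterData Wd p,
            ‖LInvariant Dq * (((ϖ : ℚ) : ℚ_[p]) * (ratPlusSymbol f 0 : ℚ_[p]))‖ =
              ‖padicLog p (cyclotomicGenerator p : ℚ_[p])‖) →
        ∀ (L : PowerSeries ℚ_[p]), IsMultPAdicLFunctionOf f p 1 L →
          ∃ n : ℕ, ‖PowerSeries.coeff n (PowerSeries.C ((ϖ : ℚ) : ℚ_[p]) * L)‖ = 1 := by
  sorry

/-! ## Composition (sorry-free): the three stubs + the landed unit-value theorem give the crux BY NAME -/

/-- **`NonSurjCornerTwinMuAnDeep_of`** — case split on the sign of the twin at `p`, then on the certificate locus. -/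
theorem NonSurjCornerTwinMuAnDeep_of :
    Summit.BirchSwinnertonDyer.BirchSwinnertonDyer.Theses.ErratumRoadFive.NonSurjCornerTwinMuAnDeep := by
  show Summit.BirchSwinnertonDyer.BirchSwinnertonDyer.Theorems.NonSurjCornerTwinMuAnDeep
  intro W _ _ p _ hX hns hp hdeep hram hsha K _ _ Wd _ _ Cd hK hHN hLt hWd hXa hnsd hdeepd N _ f hf ϖ hϖ a L hsa hna hL
  by_cases hsplit : Wd.HasSplitMultiplicativeReductionAtPrime p
  · have ha : a = 1 := hsa hsplit
    subst ha
    by_cases hcert : ∃ Dq : TateParameterData Wd p,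
        ‖LInvariant Dq * (((ϖ : ℚ) : ℚ_[p]) * (ratPlusSymbol f 0 : ℚ_[p]))‖ =
          ‖padicLog p (cyclotomicGenerator p : ℚ_[p])‖
    · exact stub_splitRowsOfUnitDerivative W p hX hns hp hdeep hram hsha K Wd Cd hK hHN hLt hWd hXa hnsd hdeepd hsplit
        f hf ϖ hϖ hcert L hL
    · exact stub_splitRowsOffUnitDerivative W p hX hns hp hdeep hram hsha K Wd Cd hK hHN hLt hWd hXa hnsd hdeepd hsplit
        f hf ϖ hϖ hcert L hL
  · have ha : a = -1 := hna hsplit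
    subst ha
    by_cases hunit : ‖((ϖ : ℚ) : ℚ_[p]) * (ratPlusSymbol f 0 : ℚ_[p])‖ = 1
    · exact Summit.BirchSwinnertonDyer.BirchSwinnertonDyer.Theorems.nonSurjCornerTwinMuAn_nonsplit_of_unit_value
        Wd p hXa hnsd hp hdeepd hsplit f hf ϖ hϖ L hL hunit
    · exact stub_nonsplitRowsOffUnitValue W p hX hns hp hdeep hram hsha K Wd Cd hK hHN hLt hWd hXa hnsd hdeepd hsplit
        f hf ϖ hϖ hunit L hL

end Summit.BirchSwinnertonDyer.BirchSwinnertonDyer.Cruxes.NonSurjCornerTwinMuAnDeep.Anchors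

end
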